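import Literature.RepresentationTheory.HeisenbergGroup.DualLatticePair
import Mathlib.Analysis.Normed.Group.Ultra
import HarnessLib

/-!
# The rank-one dual lattice pair of a non-archimedean field: the unit ball `𝒪` and the conductor lattice `𝔠_ψ` of `ψ`

Topic `RepresentationTheory/HeisenbergGroup`; namespace `Literature.RepresentationTheory.HeisenbergGroup`.  KERNEL ONLY:
one definition with body (`mulDual`) and proved theorems; no named fact, no record, no `sorry`.

For `F` a non-archimedean normed field with compact closed balls and `ψ : F → S¹` continuous and non-trivial, the unit
ball `𝒪 = {‖s‖ ≤ 1}` and the CONDUCTOR LATTICE `𝔠_ψ = {t ; ψ(s t) = 1 ∀ s ∈ 𝒪}` form a dual lattice pair for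
multiplication `(s, t) ↦ ψ(s t)` (`IsDualLatticePair (LinearMap.mul F F) ψ 𝒪 𝔠_ψ`): `𝔠_ψ` is an open (ψ is trivial
near `0`, [MoeglinVignerasWaldspurger1987, Chap. 2 I.2]) compact (bounded by `‖t₀‖` for any `ψ(t₀) ≠ 1`) subgroup, and
`^⊥𝔠_ψ = 𝒪` is the tree's one-variable separation `SchrodingerIrreducible.exists_mul_sep` ([ibid., I.3]
"`(A^⊥)^⊥ = A`").  With a non-zero element of norm `< 1` the unit scalings of both shrink to `0`.  This is the LOCAL
INPUT of the rank-one-to-rank-`n` reduction `DualLatticePairPi.lean` (boxes `𝒪ⁿ × 𝔠_ψⁿ` for the dot-product pairing of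
a Darboux basis) and of restricted products over the places ([Weil1964, Chap. III n° 37–39]).

* §1 **`mulDual ψ`** and its membership lemma; `isOpen_mulDual`, `norm_lt_of_mem_mulDual`, `isCompact_mulDual`;
* §2 **`isDualLatticePair_unitBall_mulDual`**;
* §3 **`exists_units_smul_subset_of_isBounded`** (scalings `cᵏ S` of a bounded subgroup), `exists_units_smul_unitBall_subset`,
  `exists_units_smul_mulDual_subset`.

Nothing of the cited sources is asserted; everything is proved from Mathlib and the tree.

## References
* [MoeglinVignerasWaldspurger1987] C. Mœglin, M.-F. Vignéras, J.-L. Waldspurger, LNM 1291 (1987), Chap. 2 I.2 (characters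
  are locally constant), I.3 (`A^⊥`, `(A^⊥)^⊥ = A`).
* [Weil1964] A. Weil, Acta Math. 111 (1964), Chap. I n° 11, Chap. III n° 37–39.
-/

set_option autoImplicit false

noncomputable section

open Set Filter Topology
open scoped Pointwise

namespace Literature.RepresentationTheory.HeisenbergGroup

open SchrodingerIrreducible

variable {F : Type*} [NormedField F] (ψ : AddChar F Circle)

/-! ## §1 The conductor lattice `𝔠_ψ` -/

/-- **the conductor lattice `𝔠_ψ = {t ; ∀ s, ‖s‖ ≤ 1 → ψ(s t) = 1}`** of a character `ψ` of a normed field: the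
dual of the unit ball for the pairing `ψ(s t)`. [cite: MoeglinVignerasWaldspurger1987, Chap. 2 I.3] -/
def mulDual : AddSubgroup F where
  carrier := {t | ∀ s : F, ‖s‖ ≤ 1 → ψ (s * t) = 1}
  add_mem' {t} {t'} ht ht' s hs := by
    rw [mul_add, AddChar.map_add_eq_mul, ht s hs, ht' s hs, one_mul]
  zero_mem' s _ := by rw [mul_zero, AddChar.map_zero_eq_one]
  neg_mem' {t} ht s hs := by rw [mul_neg, AddChar.map_neg_eq_inv, ht s hs, inv_one]

/-- membership in `𝔠_ψ`. [cite: MoeglinVignerasWaldspurger1987, Chap. 2 I.3] -/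
theorem mem_mulDual {t : F} : t ∈ mulDual ψ ↔ ∀ s : F, ‖s‖ ≤ 1 → ψ (s * t) = 1 := Iff.rfl

section Topology

variable [IsUltrametricDist F] (hψc : Continuous ψ)
include hψc

/-- **`𝔠_ψ` is open**: `ψ = 1` on `‖u‖ ≤ δ`, and `‖s t‖ ≤ ‖t‖ ≤ δ` for `‖s‖ ≤ 1`, so `𝔠_ψ ⊇ {‖t‖ ≤ δ}`.
[cite: MoeglinVignerasWaldspurger1987, Chap. 2 I.2] -/
theorem isOpen_mulDual : IsOpen (mulDual ψ : Set F) := by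
  obtain ⟨δ, hδ, hδ1⟩ := exists_radius_addChar_eq_one ψ hψc
  apply (mulDual ψ).isOpen_of_mem_nhds (g := 0)
  rw [Metric.mem_nhds_iff]
  refine ⟨δ, hδ, fun t ht s hs => hδ1 _ ?_⟩
  rw [norm_mul]
  calc ‖s‖ * ‖t‖ ≤ 1 * δ := mul_le_mul hs (le_of_lt (mem_ball_zero_iff.1 ht)) (norm_nonneg _) zero_le_one
    _ = δ := one_mul δ

omit [IsUltrametricDist F] hψc in
/-- **`𝔠_ψ` is bounded**: if `ψ t₀ ≠ 1` then every `t ∈ 𝔠_ψ` has `‖t‖ < ‖t₀‖` (else `s = t₀ / t ∈ 𝒪` gives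
`ψ(t₀) = 1`). [cite: MoeglinVignerasWaldspurger1987, Chap. 2 I.3] -/
theorem norm_lt_of_mem_mulDual {t₀ : F} (ht₀ : ψ t₀ ≠ 1) {t : F} (ht : t ∈ mulDual ψ) : ‖t‖ < ‖t₀‖ := by
  by_contra hle
  push Not at hle
  have ht0 : t ≠ 0 := by
    intro h
    rw [h, norm_zero] at hle
    have : t₀ = 0 := norm_le_zero_iff.1 hle
    rw [this, AddChar.map_zero_eq_one] at ht₀
    exact ht₀ rfl
  have h1 : ‖t₀ / t‖ ≤ 1 := by
    rw [norm_div, div_le_one (norm_pos_iff.2 ht0)]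
    exact hle
  have h2 := ht (t₀ / t) h1
  rw [div_mul_cancel₀ t₀ ht0] at h2
  exact ht₀ h2

/-- **`𝔠_ψ` is compact** (`ψ ≠ 1`, compact closed balls): closed (an open subgroup) and bounded.
[cite: MoeglinVignerasWaldspurger1987, Chap. 2 I.3] -/
theorem isCompact_mulDual [ProperSpace F] (hψ1 : ∃ t, ψ t ≠ 1) : IsCompact (mulDual ψ : Set F) := by
  obtain ⟨t₀, ht₀⟩ := hψ1
  refine (isCompact_closedBall (0 : F) ‖t₀‖).of_isClosed_subset
    ((mulDual ψ).isClosed_of_isOpen (isOpen_mulDual ψ hψc)) fun t ht => ?_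
  rw [mem_closedBall_zero_iff]
  exact (norm_lt_of_mem_mulDual ψ ht₀ ht).le

end Topology

/-! ## §2 The dual lattice pair `(𝒪, 𝔠_ψ)` -/

/-- **the rank-one dual lattice pair of a finite place**: for `ψ` continuous and non-trivial on a non-archimedean field
with compact closed balls, the unit ball `𝒪` and the conductor lattice `𝔠_ψ` form a dual lattice pair for
`(s, t) ↦ ψ(s t)` — `𝔠_ψ = 𝒪^⊥` by definition, `^⊥𝔠_ψ = 𝒪` by the one-variable separation `exists_mul_sep`.
[cite: MoeglinVignerasWaldspurger1987, Chap. 2 I.3] -/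
theorem isDualLatticePair_unitBall_mulDual [IsUltrametricDist F] [ProperSpace F] (hψc : Continuous ψ)
    (hψ1 : ∃ t, ψ t ≠ 1) :
    IsDualLatticePair (LinearMap.mul F F) ψ (IsUltrametricDist.closedBall_openAddSubgroup F one_pos).toAddSubgroup
      (mulDual ψ) where
  isCompact_left := isCompact_closedBall _ _
  isOpen_left := IsUltrametricDist.isOpen_closedBall _ one_ne_zero
  isCompact_right := isCompact_mulDual ψ hψc hψ1
  isOpen_right := isOpen_mulDual ψ hψc
  mem_right_iff t := by
    constructor
    · intro ht s hs
      rw [LinearMap.mul_apply']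
      exact ht s (mem_closedBall_zero_iff.1 hs)
    · intro ht s hs
      have h := ht s (mem_closedBall_zero_iff.2 hs)
      rwa [LinearMap.mul_apply'] at h
  mem_left_iff s := by
    constructor
    · intro hs t ht
      rw [LinearMap.mul_apply']
      exact ht s (mem_closedBall_zero_iff.1 hs)
    · intro hs
      by_contra hsn
      have hs1 : 1 < ‖s‖ := not_le.1 fun h => hsn (mem_closedBall_zero_iff.2 h)
      obtain ⟨t, ht1, hne⟩ := exists_mul_sep ψ hψc hψ1 one_pos hs1
      have ht : t ∈ mulDual ψ := fun s' hs' => by rw [mul_comm]; exact ht1 s' hs'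
      exact hne (by rw [mul_comm]; exact hs t ht)

/-! ## §3 Unit scalings shrink to `0` -/

/-- **small scalings** (rank one): if `F` has an element `c` with `0 < ‖c‖ < 1`, then for every bounded additive
subgroup `S` of `F` and every neighbourhood `N` of `0` some unit scaling `cᵏ S` lies in `N`.
[cite: Weil1964, Chap. I n° 11] -/
theorem exists_units_smul_subset_of_isBounded (hF : ∃ c : F, 0 < ‖c‖ ∧ ‖c‖ < 1) (S : AddSubgroup F)
    (hS : Bornology.IsBounded (S : Set F)) (N : Set F) (hN : N ∈ 𝓝 (0 : F)) :
    ∃ a : Fˣ, (((a : F) • S : AddSubgroup F) : Set F) ⊆ N := by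
  obtain ⟨c, hc0, hc1⟩ := hF
  obtain ⟨ε, hε, hεN⟩ := Metric.mem_nhds_iff.1 hN
  obtain ⟨R, hR⟩ := hS.subset_closedBall 0
  have hR1 : 0 < max R 1 := lt_of_lt_of_le one_pos (le_max_right _ _)
  obtain ⟨k, hk⟩ := exists_pow_lt_of_lt_one (div_pos hε hR1) hc1
  have hck : c ^ k ≠ 0 := pow_ne_zero _ (norm_pos_iff.1 hc0)
  refine ⟨Units.mk0 (c ^ k) hck, fun x hx => hεN ?_⟩
  obtain ⟨s, hs, rfl⟩ := (AddSubgroup.mem_smul_pointwise_iff_exists _ _ _).1 hx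
  rw [Units.val_mk0, mem_ball_zero_iff, smul_eq_mul, norm_mul, norm_pow]
  have hsR : ‖s‖ ≤ max R 1 := (mem_closedBall_zero_iff.1 (hR hs)).trans (le_max_left _ _)
  calc ‖c‖ ^ k * ‖s‖ ≤ ‖c‖ ^ k * max R 1 := by gcongr
    _ < ε / max R 1 * max R 1 := by gcongr
    _ = ε := div_mul_cancel₀ ε hR1.ne'

/-- the unit ball's scalings shrink to `0`. [cite: Weil1964, Chap. I n° 11] -/
theorem exists_units_smul_unitBall_subset [IsUltrametricDist F] (hF : ∃ c : F, 0 < ‖c‖ ∧ ‖c‖ < 1) (N : Set F)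
    (hN : N ∈ 𝓝 (0 : F)) :
    ∃ a : Fˣ, (((a : F) • (IsUltrametricDist.closedBall_openAddSubgroup F one_pos).toAddSubgroup : AddSubgroup F) :
      Set F) ⊆ N :=
  exists_units_smul_subset_of_isBounded hF _ Metric.isBounded_closedBall N hN

/-- the conductor lattice's scalings shrink to `0` (`𝔠_ψ` is compact, hence bounded). [cite: Weil1964, Chap. I n° 11] -/
theorem exists_units_smul_mulDual_subset [IsUltrametricDist F] [ProperSpace F] (hψc : Continuous ψ)
    (hψ1 : ∃ t, ψ t ≠ 1) (hF : ∃ c : F, 0 < ‖c‖ ∧ ‖c‖ < 1) (N : Set F) (hN : N ∈ 𝓝 (0 : F)) :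
    ∃ a : Fˣ, (((a : F) • mulDual ψ : AddSubgroup F) : Set F) ⊆ N :=
  exists_units_smul_subset_of_isBounded hF _ (isCompact_mulDual ψ hψc hψ1).isBounded N hN

end Literature.RepresentationTheory.HeisenbergGroup

end
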